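import Literature.AlgebraicGeometry.Resolution.ProjHomogeneousIdealSheaf
import Literature.AlgebraicGeometry.Resolution.Principalization
import Literature.AlgebraicGeometry.Motives.SegreEmbedding
import HarnessLib

/-!
# Crux `PatchingRelPerfect` (stmt-ResolutionOfSingularities-16161), chain W5.2 — TargetsF4 support target
# `SingleFormBasics`: the form ideal sheaf of ONE non-zero form on `ℙ^m` is non-zero and locally principal

[OURS · L1 W5.2 · TargetsF4 support] plan-1 g7 `ChainW52TargetsF4.lean` (06:28Z) §5 `SingleFormBasics` (S/M, no named
hand; res-type-003 OFFER 06:32:51Z). CONTENT form (the by-name closure over the F4 defs module is a two-line corollary once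
that module is filed): for a field `κ₀`, `m d : ℕ`, and ONE non-zero form `P₀ ∈ κ₀[T₀,…,T_m]` of degree `d`, the ideal
sheaf `𝓟 = (P₀)~ ⊂ 𝒪_{ℙ^m_{κ₀}}` of the homogeneous ideal `(P₀)` (tree `projIdealSheaf`) is

* `≠ ⊥` — over the chart `D₊(T₀)` it is generated by `P₀/T₀^d` (`projIdealSheaf_ideal_basicOpen_span`), which is
  non-zero in `(κ₀[T]_{T₀})₀` because `κ₀[T]` is a domain and `T₀ ≠ 0`;
* LOCALLY PRINCIPAL — every point lies in some `D₊(T_l)` (the `T_l` span the irrelevant ideal,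
  `Proj.iSup_basicOpen_eq_top`), over which `𝓟` is generated by the single section `P₀/T_l^d`.

The hypothesis `1 ≤ d` of the typed target is not needed. The standard grading instance `MvPolynomial.gradedAlgebra`
is a LOCAL instance here (Mathlib's documented usage; it is not global because of weighted gradings). Fact-free; nothing here is a statement of the manuscript under
review.

## References
* R. Hartshorne, *Algebraic Geometry* (1977), II Prop. 5.11 (b), Ex. 3.12. [Hartshorne1977]
-/

-- `Summit.<Summit>.<Sub>.Theorems` with `Sub = Summit` (single-conjunct summit, D-0017)
set_option linter.dupNamespace false

noncomputable section

open CategoryTheory AlgebraicGeometry TopologicalSpace HomogeneousLocalization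
open Literature.AlgebraicGeometry.Resolution Literature.AlgebraicGeometry.Motives

namespace Summit.ResolutionOfSingularities.ResolutionOfSingularities.Theorems.DepthTargets

universe u

attribute [local instance] MvPolynomial.gradedAlgebra

/-- Over the chart `D₊(T_l)` the form ideal sheaf of one form `P₀` of degree `d` is generated by the single section
`P₀/T_l^d`. [cite: Hartshorne1977, II Prop. 5.11 (b)] -/
theorem projIdealSheaf_single_ideal_basicOpen (κ₀ : Type u) [Field κ₀] (m d : ℕ)
    (P : Fin 1 → MvPolynomial (Fin (m + 1)) κ₀)
    (hP : ∀ j, P j ∈ MvPolynomial.homogeneousSubmodule (Fin (m + 1)) κ₀ d) (l : Fin (m + 1)) :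
    (projIdealSheaf (MvPolynomial.homogeneousSubmodule (Fin (m + 1)) κ₀)
        ⟨Ideal.span (Set.range P), isHomogeneous_span_of_forall_mem _ P (fun _ => d) hP⟩).ideal
      ⟨Proj.basicOpen (MvPolynomial.homogeneousSubmodule (Fin (m + 1)) κ₀) (MvPolynomial.X l),
        Proj.isAffineOpen_basicOpen _ (MvPolynomial.X l) (MvPolynomial.isHomogeneous_X κ₀ l) one_pos⟩ =
      Ideal.span {(Proj.awayToSection (MvPolynomial.homogeneousSubmodule (Fin (m + 1)) κ₀)
        (MvPolynomial.X l)).hom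
        (mk₁ (MvPolynomial.homogeneousSubmodule (Fin (m + 1)) κ₀) (MvPolynomial.isHomogeneous_X κ₀ l) d (P 0)
          (hP 0))} := by
  rw [projIdealSheaf_ideal_basicOpen_span (MvPolynomial.homogeneousSubmodule (Fin (m + 1)) κ₀) P (fun _ => d) hP
    _ (MvPolynomial.isHomogeneous_X κ₀ l)]
  congr 1
  ext a
  simp only [Set.mem_range, Set.mem_singleton_iff]
  constructor
  · rintro ⟨j, rfl⟩
    obtain rfl : j = 0 := Subsingleton.elim j 0
    rfl
  · rintro rfl
    exact ⟨0, rfl⟩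

/-- **`SingleFormBasics`, content form**: the form ideal sheaf `(P₀)~` of one non-zero form of degree `d` on `ℙ^m_{κ₀}`
is non-zero and locally principal. [cite: Hartshorne1977, II Prop. 5.11 (b)] -/
theorem projIdealSheaf_single_ne_bot_and_isLocallyPrincipal (κ₀ : Type u) [Field κ₀] (m d : ℕ)
    (P : Fin 1 → MvPolynomial (Fin (m + 1)) κ₀)
    (hP : ∀ j, P j ∈ MvPolynomial.homogeneousSubmodule (Fin (m + 1)) κ₀ d) (hP0 : P 0 ≠ 0) :
    projIdealSheaf (MvPolynomial.homogeneousSubmodule (Fin (m + 1)) κ₀)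
        ⟨Ideal.span (Set.range P), isHomogeneous_span_of_forall_mem _ P (fun _ => d) hP⟩ ≠ ⊥ ∧
      IsLocallyPrincipal (projIdealSheaf (MvPolynomial.homogeneousSubmodule (Fin (m + 1)) κ₀)
        ⟨Ideal.span (Set.range P), isHomogeneous_span_of_forall_mem _ P (fun _ => d) hP⟩) := by
  set 𝒜 := MvPolynomial.homogeneousSubmodule (Fin (m + 1)) κ₀ with h𝒜
  set 𝓟 := projIdealSheaf 𝒜 ⟨Ideal.span (Set.range P), isHomogeneous_span_of_forall_mem _ P (fun _ => d) hP⟩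
    with h𝓟
  have hX : ∀ l : Fin (m + 1), (MvPolynomial.X l : MvPolynomial (Fin (m + 1)) κ₀) ∈ 𝒜 1 :=
    fun l => MvPolynomial.isHomogeneous_X κ₀ l
  -- the charts `D₊(T_l)` and the single generators over them
  let U : Fin (m + 1) → (Proj 𝒜).affineOpens := fun l =>
    ⟨Proj.basicOpen 𝒜 (MvPolynomial.X l), Proj.isAffineOpen_basicOpen _ (MvPolynomial.X l) (hX l) one_pos⟩
  have hU : ∀ l, 𝓟.ideal (U l) = Ideal.span {(Proj.awayToSection 𝒜 (MvPolynomial.X l)).hom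
      (mk₁ 𝒜 (hX l) d (P 0) (hP 0))} := fun l =>
    projIdealSheaf_single_ideal_basicOpen κ₀ m d P hP l
  refine ⟨fun h0 => hP0 ?_, fun x => ?_⟩
  · -- `≠ ⊥`: the generator over `D₊(T₀)` would vanish, hence `P₀ = 0` in the domain `κ₀[T]`
    have h1 := hU 0
    rw [h0, Scheme.IdealSheafData.ideal_bot, Pi.bot_apply, eq_comm, Ideal.span_singleton_eq_bot] at h1
    -- `awayToSection` is an isomorphism over `D₊(T₀)` (degree one)
    have hiso : Function.Injective (Proj.awayToSection 𝒜 (MvPolynomial.X (0 : Fin (m + 1)))).hom := by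
      have : IsIso (Proj.awayToSection 𝒜 (MvPolynomial.X (0 : Fin (m + 1)))) :=
        (Proj.basicOpenIsoAway 𝒜 (MvPolynomial.X 0) (hX 0) one_pos).isIso_hom
      exact (ConcreteCategory.bijective_of_isIso (Proj.awayToSection 𝒜 (MvPolynomial.X (0 : Fin (m + 1))))).1
    have h2 : mk₁ 𝒜 (hX 0) d (P 0) (hP 0) = 0 := hiso (by rw [h1, map_zero])
    have h3 := congrArg HomogeneousLocalization.val h2
    rw [val_mk₁, HomogeneousLocalization.val_zero, Localization.mk_eq_mk'_apply, IsLocalization.mk'_eq_zero_iff]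
      at h3
    obtain ⟨⟨c, n, rfl⟩, hc⟩ := h3
    have hXn : (MvPolynomial.X (0 : Fin (m + 1)) : MvPolynomial (Fin (m + 1)) κ₀) ^ n ≠ 0 :=
      pow_ne_zero n (MvPolynomial.X_ne_zero 0)
    exact (mul_eq_zero.mp hc).resolve_left hXn
  · -- locally principal: `x` lies in some `D₊(T_l)`
    have hcov := Proj.iSup_basicOpen_eq_top 𝒜 (fun l : Fin (m + 1) => (MvPolynomial.X l : MvPolynomial _ κ₀))
      (Segre.irrelevant_le_span_X (Fin (m + 1)) κ₀)
    have hx : x ∈ (⨆ l : Fin (m + 1), Proj.basicOpen 𝒜 (MvPolynomial.X l : MvPolynomial _ κ₀)) := by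
      rw [hcov]; trivial
    obtain ⟨l, hl⟩ := Opens.mem_iSup.mp hx
    exact ⟨U l, hl, _, hU l⟩

end Summit.ResolutionOfSingularities.ResolutionOfSingularities.Theorems.DepthTargets

end
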